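import Literature.AlgebraicGeometry.Motives.HodgeThetaSubalgebraUnitaryConstantRankLeviThree
import Literature.AlgebraicGeometry.Motives.HodgeThetaSubalgebraUnitaryLeviFull
import HarnessLib

/-!
# High-rank pruning for `Θ`-subalgebras of unitary type: a raising operator whose Levi pieces are too small for
# the minimal raising rank cannot exist (Ribet 1983 Thm. 3, Lie step — a tool of the minimal-rank method)

Family `hodge`, layer `Literature/AlgebraicGeometry/Motives` (pure linear algebra over `ℂ`; no geometry). Research
context: cell `pub-hodge-ring2` (HONEST FRAMING: research route conditional on HC_CM; not a corollary; Q11.4-sentence-2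
already refuted in dim ≥ 3), Literature lane gen 89. UNCONDITIONAL; theorems only, no definition, no named fact
(D-0026), no `sorry`.

THE PRINT. K. A. Ribet, Amer. J. Math. 105 (1983), Thm. 3 = Gordon's survey Thm. 6.3 (3) [held
`paper:arxiv-alg-geom_9709030` p. 18]: `End⁰ = K` imaginary quadratic acting with relatively prime multiplicities
`(n′, n″)` ⟹ `Hg = Lf`, `B•(Aⁿ) = D•(Aⁿ)`. Ribet's Lie step invokes Serre's classification-based lemma; the lane
replaces it by the minimal-rank method (`HodgeThetaSubalgebraUnitarySixteenTwentyOneCore` and its successors), cell by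
cell. THIS FILE adds one general tool to that method.

THE TOOL (**`UnitaryRankPrune.false_of_pieces_lt`**). Setting of the unitary cores (`𝔊 ⊆ End(W)` bracket-closed,
irreducible, `Θ ∈ 𝔊` an involution with pieces `P`, `Q` of dimensions `a`, `b`, Hermitian data, adjoint-closed); let
every non-zero raising operator of `𝔊` have rank `≥ m`, and let `B ∈ 𝔊` be raising of rank `r` with `0 < r < a`
(NOT necessarily of minimal rank). The Levi involution `ι` of `B` (`UnitaryLeviSetup.exists_levi_pair`) has pieces
`U⁺ ⊇ PU ⊕ QU` of type `(a − r | r)` and `U⁻` of type `(r | b − r)`; a raising `X ∈ 𝔊` commuting with `ι` has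
`rk X = rk X|U⁺ + rk X|U⁻ ≤ min(a − r, r) + min(r, b − r)` (ibid., clause (f)), while the non-vanishing lemma
`UnitaryLeviFull.exists_raise_commute_apply_ne_zero` produces such an `X ≠ 0` as soon as `PU ≠ 0 ≠ QU`. Hence
`min(a − r, r) + min(r, b − r) < m` is impossible. At `r = m` this is TOOL F for `𝔊` itself
(`UnitaryConstantRank.false_of_le_rank`); the point of the general form is to PRUNE the admissible raising ranks ABOVE
the minimal one before the profile analysis at a minimal base point: e.g. in the `p = 53` cell `(26 | 27)` at `m = 12`
the ranks `21, 24` are pruned (`min(5, 21) + min(21, 6) = 11`, `min(2, 24) + min(24, 3) = 5`), which removes the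
`(12, 12)` profile of rank `24` and restores the exclusivity of the Levi profiles.

## References
* [Ribet1983] K. A. Ribet, *Hodge classes on certain types of abelian varieties*, Amer. J. Math. 105 (1983), Thm. 3.
* [Gordon1997] B. B. Gordon, *A survey of the Hodge conjecture for abelian varieties*, Thm. 6.3 (3), pp. 18–19.
* [Deligne1982HodgeCycles] P. Deligne, *Hodge cycles on abelian varieties*, LNM 900 (1982), I §3 Prop. 3.4, 3.6.
* [GoodmanWallachGTM255] R. Goodman, N. R. Wallach, GTM 255 (2009), §4.1.1.
* [HoffmanKunze1971LinearAlgebra] K. Hoffman, R. Kunze, *Linear Algebra* (1971), §3.1 Thm. 2 (rank–nullity).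
-/

noncomputable section

open Module

namespace Literature.AlgebraicGeometry.Motives

namespace HodgeStructure

universe u

variable {W : Type u} [AddCommGroup W] [Module ℂ W]

/-- **High-rank pruning.** In the setting of the unitary cores, if every non-zero raising operator of `𝔊` has rank
`≥ m` and `B ∈ 𝔊` is raising of rank `r` with `0 < r < dim P` and `min(dim P − r, r) + min(r, dim Q − r) < m`, then
`False`: the non-vanishing raising operator commuting with the Levi involution of `B` has rank at most
`min(dim P − r, r) + min(r, dim Q − r)`. [cite: Ribet1983, Thm. 3] [cite: Gordon1997, Thm. 6.3 (3)]
[cite: Deligne1982HodgeCycles, I §3 Prop. 3.4, 3.6] [cite: GoodmanWallachGTM255, §4.1.1]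
[cite: HoffmanKunze1971LinearAlgebra, §3.1 Thm. 2] -/
theorem UnitaryRankPrune.false_of_pieces_lt [FiniteDimensional ℂ W] {𝔊 : Submodule ℂ (Module.End ℂ W)}
    (hbr : ∀ Y ∈ 𝔊, ∀ Z ∈ 𝔊, Y * Z - Z * Y ∈ 𝔊)
    (hirr : ∀ U : Submodule ℂ W, (∀ A ∈ 𝔊, ∀ u ∈ U, A u ∈ U) → U = ⊥ ∨ U = ⊤)
    {Θ : Module.End ℂ W} (hΘ : Θ ∈ 𝔊) (hΘΘ : Θ * Θ = 1)
    {P Q : Submodule ℂ W} (hP : ∀ x, x ∈ P ↔ Θ x = x) (hQ : ∀ x, x ∈ Q ↔ Θ x = -x)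
    {s : W → W → ℂ} (hadd : ∀ x y z, s (x + y) z = s x z + s y z) (hsymm : ∀ x y, s y x = starRingEnd ℂ (s x y))
    (hPQ : ∀ p ∈ P, ∀ q ∈ Q, s p q = 0) (hdefP : ∀ p ∈ P, s p p = 0 → p = 0) (hdefQ : ∀ q ∈ Q, s q q = 0 → q = 0)
    (hadj : ∀ X ∈ 𝔊, ∃ Y ∈ 𝔊, ∀ x y, s (X x) y = s x (Y y))
    {m : ℕ} (hmin : ∀ Y ∈ 𝔊, Θ * Y = Y → Y * Θ = -Y → Y ≠ 0 → m ≤ Module.finrank ℂ (LinearMap.range Y))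
    {B : Module.End ℂ W} (hB : B ∈ 𝔊) (hΘB : Θ * B = B) (hBΘ : B * Θ = -B)
    (hr0 : 0 < Module.finrank ℂ (LinearMap.range B))
    (hrP : Module.finrank ℂ (LinearMap.range B) < Module.finrank ℂ P)
    (hlt : min (Module.finrank ℂ P - Module.finrank ℂ (LinearMap.range B)) (Module.finrank ℂ (LinearMap.range B)) +
      min (Module.finrank ℂ (LinearMap.range B)) (Module.finrank ℂ Q - Module.finrank ℂ (LinearMap.range B)) < m) :
    False := by
  classical
  obtain ⟨ι, Um, Up, PU, QU, -, -, -, -, -, -, -, -, hιmem, hιι, hιΘ, -, hUm, hUp, -, -,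
    -, -, hPU, hQU, -, -, -, -, hfinPU, hfinQU, -, -,
    -, -, -, -, -, -, -, -, -, -, -, -, -, -, -,
    -, -, -, -, -, -, -, -, -, -, -, -, -, -, -,
    hsplit⟩ :=
    UnitaryLeviSetup.exists_levi_pair hbr hirr hΘ hΘΘ hP hQ hadd hsymm hPQ hdefP hdefQ hadj hB hΘB hBΘ
  obtain ⟨⟨p, hp⟩, hp0⟩ := Module.finrank_pos_iff_exists_ne_zero.1 (show 0 < Module.finrank ℂ PU by omega)
  obtain ⟨⟨q, hq⟩, hq0⟩ := Module.finrank_pos_iff_exists_ne_zero.1 (show 0 < Module.finrank ℂ QU by omega)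
  obtain ⟨X₀, hX₀, hΘX₀, hX₀Θ, hX₀c, c₀, -, -, hX₀c0⟩ :=
    UnitaryLeviFull.exists_raise_commute_apply_ne_zero hbr hirr hΘ hΘΘ hQ hιmem hιι hιΘ hUm hUp
      ⟨p, fun h => hp0 (Subtype.ext h), ((hPU p).1 hp).1, ((hPU p).1 hp).2⟩
      ⟨q, fun h => hq0 (Subtype.ext h), ((hQU q).1 hq).1, ((hQU q).1 hq).2⟩
  have hX₀ne : X₀ ≠ 0 := fun h0 => hX₀c0 (by rw [h0, LinearMap.zero_apply])
  have hm := hmin X₀ hX₀ hΘX₀ hX₀Θ hX₀ne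
  obtain ⟨hs, hi, hi', hj, hj'⟩ := hsplit X₀ hΘX₀ hX₀Θ hX₀c
  omega

/-- **High-rank pruning, rank form.** As `false_of_pieces_lt`, concluding that the rank of `B` is not `r` whenever
`0 < r < dim P` and `min(dim P − r, r) + min(r, dim Q − r) < m` (the form used to prune the admissible raising ranks
before a minimal-rank analysis). [cite: Ribet1983, Thm. 3] [cite: Gordon1997, Thm. 6.3 (3)]
[cite: GoodmanWallachGTM255, §4.1.1] -/
theorem UnitaryRankPrune.rank_ne [FiniteDimensional ℂ W] {𝔊 : Submodule ℂ (Module.End ℂ W)}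
    (hbr : ∀ Y ∈ 𝔊, ∀ Z ∈ 𝔊, Y * Z - Z * Y ∈ 𝔊)
    (hirr : ∀ U : Submodule ℂ W, (∀ A ∈ 𝔊, ∀ u ∈ U, A u ∈ U) → U = ⊥ ∨ U = ⊤)
    {Θ : Module.End ℂ W} (hΘ : Θ ∈ 𝔊) (hΘΘ : Θ * Θ = 1)
    {P Q : Submodule ℂ W} (hP : ∀ x, x ∈ P ↔ Θ x = x) (hQ : ∀ x, x ∈ Q ↔ Θ x = -x)
    {a b : ℕ} (hPa : Module.finrank ℂ P = a) (hQb : Module.finrank ℂ Q = b)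
    {s : W → W → ℂ} (hadd : ∀ x y z, s (x + y) z = s x z + s y z) (hsymm : ∀ x y, s y x = starRingEnd ℂ (s x y))
    (hPQ : ∀ p ∈ P, ∀ q ∈ Q, s p q = 0) (hdefP : ∀ p ∈ P, s p p = 0 → p = 0) (hdefQ : ∀ q ∈ Q, s q q = 0 → q = 0)
    (hadj : ∀ X ∈ 𝔊, ∃ Y ∈ 𝔊, ∀ x y, s (X x) y = s x (Y y))
    {m : ℕ} (hmin : ∀ Y ∈ 𝔊, Θ * Y = Y → Y * Θ = -Y → Y ≠ 0 → m ≤ Module.finrank ℂ (LinearMap.range Y))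
    {r : ℕ} (hr0 : 0 < r) (hra : r < a) (hlt : min (a - r) r + min r (b - r) < m)
    {B : Module.End ℂ W} (hB : B ∈ 𝔊) (hΘB : Θ * B = B) (hBΘ : B * Θ = -B) :
    Module.finrank ℂ (LinearMap.range B) ≠ r := by
  intro hr
  refine UnitaryRankPrune.false_of_pieces_lt hbr hirr hΘ hΘΘ hP hQ hadd hsymm hPQ hdefP hdefQ hadj hmin hB hΘB hBΘ
    (by omega) (by omega) ?_
  rw [hr, hPa, hQb]
  exact hlt

end HodgeStructure

end Literature.AlgebraicGeometry.Motives

end
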